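import Literature.Geometry.Lorentzian.TameGaugedFamily
import Literature.Geometry.Lorentzian.TameFamilyOffCompact
import Summits.FinalStateConjecture.FinalStateConjecture.Theses.ExactKerrEnds
import Summits.FinalStateConjecture.FinalStateConjecture.Theorems.ExactKerrEndsCensorshipAlongKerrEndsCompactSettledBreathing
import Summits.FinalStateConjecture.FinalStateConjecture.Theorems.SwallowTheDatumParametricKerrBurialLine
import HarnessLib

/-!
# Route `ExactKerrEnds`, crux `CensorshipAlongKerrEnds` (stmt-FinalStateConjecture-18521), line `Sketch` v4
# (compact-support architecture): COMPACT (∃ 𝒟 : VacuumCauchyDevelopment D, 𝒟.IsMaximal) ∧ ∀ 𝒟 : VacuumCauchyDevelopment D, 𝒟.IsMaximal → HasCompleteNullInfinity 𝒟.toCauchyDevelopment ∧ ∃ (O : Set 𝒟.carrier) (dd : FinalStateDecomposition 𝒟.toSpacetime O 2), (∀ i, Kerr.IsSubextremal (dd.mass i) (dd.spin i)) ∧ O = exteriorOf 𝒟.toCauchyDevelopment dd.charted ∧ RaysStayInClosure 𝒟.toCauchyDevelopment O ∧ HasExhaustiveCharts dd ∧ IsFutureOriented dd TAME ACCESS from SMOOTH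 compactly supported settled deformations

The v4 composition of line `Sketch` consumes, through every admissible datum `d`, a TAME, IMMERSED curve of admissible data,
settled off `0` on a window, which agrees with `d` off one compact set ("compact settled tame access").  This file
proves that the physics behind it can be asked in the WEAKEST witness form — a merely SMOOTH one-parameter, compactly
supported deformation of `d` inside the admissible class whose small non-zero members are settled (Christodoulou's lines
`α₀ + c f`, `f` of compact support, without linearity): tameness is automatic for compactly supported smooth families
(`InitialDataSet.isTameDataFamily_restrict_of_agree_off_compact_one`, `TameFamilyOffCompact.lean`) and immersion at `0`
(with injectivity) is GAUGE-BORNE (`TameGaugedFamily.lean`, prover seat 0 of the route, p165766): the gauged family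
`c ↦ E_{c₀}(F (ρ c))` of the quadratically reparametrised curve on a breathing ball far out is tame, immersed, admissible,
still a compactly supported deformation of `d` (the breathing diffeomorphisms are the identity off the compact breathing
core, `AFEnd.breatheFamily_eq_of_not_mem_core`) and still settled off `0` (settledness is breathing-invariant,
`summit_breatheFamily`); the window is then handled by `exists_tameCurve_of_localWindow` with the member class
"admissible AND equal to `d` off `K ∪ core`".

* `exists_compactSettledAccess_of_smooth` — the upgrade at one datum;
* `compactSettledTameAccess_of_smoothCompactExits` — registered sub-goal of the crux item: compact settled tame access
  at EVERY admissible datum from MGHD existence (stmt-9937) and the two SMOOTH COMPACT EXITS (registered stubs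
  `stub_smoothCompactNakedExit`, `stub_smoothCompactCensoredExit`: the summit's settled exits stmt-17383 / stmt-17348 in
  the weakest witness form), with the landed `stub_compactSettledBreathing` (p166170) at a settled base.

References: Christodoulou, CQG 16 (1999) A23, p. A24; Dafermos–Rodnianski arXiv:0811.0354, App. B.2.3; J. M. Lee,
Introduction to Smooth Manifolds (2013), Prop. 2.25.
-/

-- the summit-side namespace `Summit.FinalStateConjecture.FinalStateConjecture.…` (summit = problem)
-- doubles the `FinalStateConjecture` path component by design; `dupNamespace` would flag every decl.
set_option linter.dupNamespace false

noncomputable section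

open scoped Manifold ContDiff Topology ENNReal
open Set Function Filter TopologicalSpace Literature.Geometry.Lorentzian
open Summit.FinalStateConjecture.FinalStateConjecture.Theses.ExactKerrEnds (MGHDExists)
open Summit.FinalStateConjecture.FinalStateConjecture.Theorems.SwallowTheDatum.ParametricKerrBurial (AgreeAt)
open Summit.FinalStateConjecture.FinalStateConjecture.Theorems.PhaseMixingCaptureCaptureSufficesC2 (summit_breatheFamily)

namespace Summit.FinalStateConjecture.FinalStateConjecture.Theorems.ExactKerrEnds.CensorshipAlongKerrEnds

section Upgrade

variable {X : Type} [TopologicalSpace X] [ChartedSpace E3 X] [IsManifold (𝓡 3) ∞ X] [T2Space X]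
  [SecondCountableTopology X] [ConnectedSpace X]

/-- In `ℝ¹`, the quadratic axis point `ρ c = (c 0)² e₀` has norm `≤ ‖c‖` when `‖c‖ ≤ 1`. [folklore] -/
theorem norm_quadAxis_le {c : EuclideanSpace ℝ (Fin 1)} (hc : ‖c‖ ≤ 1) :
    ‖(EuclideanSpace.single 0 ((c 0) ^ 2) : EuclideanSpace ℝ (Fin 1))‖ ≤ ‖c‖ := by
  have h0 : ‖c 0‖ ≤ ‖c‖ := PiLp.norm_apply_le c 0
  rw [PiLp.norm_single, norm_pow, pow_two]
  calc ‖c 0‖ * ‖c 0‖ ≤ ‖c‖ * 1 := mul_le_mul h0 (h0.trans hc) (norm_nonneg _) (norm_nonneg _)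
    _ = ‖c‖ := mul_one _

/-- **Compact settled tame access from a SMOOTH compactly supported settled deformation** (the gauge-borne upgrade
for compactly supported witnesses).  Let `d` be admissible and `F : ℝ¹ → data` jointly smooth with `F 0 = d`, admissible
members, all members equal to `d` (metric and `k`, pointwise) off one compact `K`, and settled members for
`0 < ‖c‖ < ε`.  Then through `d` passes a TAME (on a collared end), IMMERSED curve `G` of admissible data, `G 0 = d`,
whose members agree with `d` off a compact set and are settled for ALL `c ≠ 0`: `F` is tame on the collared sole end of
`d` (`isTameDataFamily_restrict_of_agree_off_compact_one`); its gauged family on a breathing ball far out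
(`AFEnd.isTameDataFamily_restrict_breatheQuad`, `isImmersedAtZero_breatheQuad`) is admissible, equal to `d` off
`K ∪ breatheCore` and settled off `0` on a window (`summit_breatheFamily`); `exists_tameCurve_of_localWindow` with the
member class "admissible and equal to `d` off `K ∪ breatheCore`". [cite: Christodoulou1999, p. A24] -/
theorem exists_compactSettledAccess_of_smooth {d : InitialDataSet (𝓡 3) X} (hd : d ∈ admissibleVacuumData X)
    {F : EuclideanSpace ℝ (Fin 1) → InitialDataSet (𝓡 3) X} (hF : InitialDataSet.IsSmoothDataFamily 1 F)
    (hF0 : F 0 = d) (hFadm : ∀ c, F c ∈ admissibleVacuumData X) {K : Set X} (hK : IsCompact K)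
    (hagree : ∀ (c : EuclideanSpace ℝ (Fin 1)) (x : X), x ∉ K → (F c).h.inner x = d.h.inner x ∧ (F c).k x = d.k x)
    {ε : ℝ} (hε : 0 < ε)
    (hgood : ∀ c : EuclideanSpace ℝ (Fin 1), c ≠ 0 → ‖c‖ < ε → (∃ 𝒟 : VacuumCauchyDevelopment (F c), 𝒟.IsMaximal) ∧ ∀ 𝒟 : VacuumCauchyDevelopment (F c), 𝒟.IsMaximal → HasCompleteNullInfinity 𝒟.toCauchyDevelopment ∧ ∃ (O : Set 𝒟.carrier) (dd : FinalStateDecomposition 𝒟.toSpacetime O 2), (∀ i, Kerr.IsSubextremal (dd.mass i) (dd.spin i)) ∧ O = exteriorOf 𝒟.toCauchyDevelopment dd.charted ∧ RaysStayInClosure 𝒟.toCauchyDevelopment O ∧ HasExhaustiveCharts dd ∧ IsFutureOriented dd) :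
    ∃ (e : AFEnd X) (G : EuclideanSpace ℝ (Fin 1) → InitialDataSet (𝓡 3) X),
      InitialDataSet.IsTameDataFamily e 1 G ∧ InitialDataSet.IsImmersedAtZero 1 G ∧ G 0 = d ∧
        (∀ c, G c ∈ admissibleVacuumData X) ∧
        (∃ K' : Set X, IsCompact K' ∧ ∀ (c : EuclideanSpace ℝ (Fin 1)) (x : X), x ∉ K' → AgreeAt (G c) d x) ∧
        ∃ ε' > (0 : ℝ), ∀ c : EuclideanSpace ℝ (Fin 1), c ≠ 0 → ‖c‖ < ε' → (∃ 𝒟 : VacuumCauchyDevelopment (G c), 𝒟.IsMaximal) ∧ ∀ 𝒟 : VacuumCauchyDevelopment (G c), 𝒟.IsMaximal → HasCompleteNullInfinity 𝒟.toCauchyDevelopment ∧ ∃ (O : Set 𝒟.carrier) (dd : FinalStateDecomposition 𝒟.toSpacetime O 2), (∀ i, Kerr.IsSubextremal (dd.mass i) (dd.spin i)) ∧ O = exteriorOf 𝒟.toCauchyDevelopment dd.charted ∧ RaysStayInClosure 𝒟.toCauchyDevelopment O ∧ HasExhaustiveCharts dd ∧ IsFutureOriented dd := by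
  obtain ⟨-, e₀, M, hsole, hDR⟩ := id hd
  -- `F` is tame on the collared sole end of `d`
  have hR₁ : e₀.R < e₀.R + 1 := by linarith
  have hDR0 : e₀.IsStronglyAsymptoticallyFlatDR (F 0) M := by rw [hF0]; exact hDR
  have hagree0 : ∀ c, ∀ x ∉ K, (F c).h.inner x = (F 0).h.inner x ∧ (F c).k x = (F 0).k x := by
    intro c x hx; rw [hF0]; exact hagree c x hx
  have hFt : InitialDataSet.IsTameDataFamily (e₀.restrict hR₁.le) 1 F :=
    InitialDataSet.isTameDataFamily_restrict_of_agree_off_compact_one hF hsole hDR0 hK hagree0 hR₁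
  set e₁ : AFEnd X := e₀.restrict hR₁.le with he₁
  -- a breathing ball far out on `e₁`
  set z₀ : E3 := (e₁.R + 3) • EuclideanSpace.single (0 : Fin 3) (1 : ℝ) with hz₀
  have hz₀n : ‖z₀‖ = e₁.R + 3 := by
    rw [hz₀, norm_smul, PiLp.norm_single, norm_one, mul_one, Real.norm_of_nonneg (by linarith [e₁.R_pos])]
  have B : e₁.BreathingData z₀ 1 := ⟨one_pos, by rw [hz₀n]; linarith⟩
  have hR₂ : e₁.R < e₁.R + 1 := by linarith
  -- the gauged family: tame on the collar, immersed at `0`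
  have h2 := AFEnd.isTameDataFamily_restrict_breatheQuad B F hFt hR₂
  have h3 := AFEnd.isImmersedAtZero_breatheQuad B F hF
  -- its members are admissible and agree with `d` off `K ∪ breatheCore`
  have hK' : IsCompact (K ∪ AFEnd.breatheCore e₁ z₀ 1) := hK.union (AFEnd.isCompact_breatheCore B)
  have hmem : ∀ c : EuclideanSpace ℝ (Fin 1),
      AFEnd.breatheFamily B (F (EuclideanSpace.single 0 ((c 0) ^ 2))) (c 0) ∈
        {D | D ∈ admissibleVacuumData X ∧ ∀ x ∉ K ∪ AFEnd.breatheCore e₁ z₀ 1, AgreeAt D d x} := by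
    intro c
    refine ⟨AFEnd.breatheQuad_mem_admissibleVacuumData B F hFadm c, fun x hx ↦ ?_⟩
    rw [mem_union, not_or] at hx
    obtain ⟨h1, h2'⟩ := AFEnd.breatheFamily_eq_of_not_mem_core B (F (EuclideanSpace.single 0 ((c 0) ^ 2))) (c 0) hx.2
    obtain ⟨h3', h4⟩ := hagree (EuclideanSpace.single 0 ((c 0) ^ 2)) x hx.1
    exact ⟨h1.trans h3', h2'.trans h4⟩
  -- and settled off `0` on the window `‖c‖ < min 1 ε`
  have hε'' : 0 < min 1 ε := lt_min one_pos hε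
  have hsettled : ∀ c : EuclideanSpace ℝ (Fin 1), c ≠ 0 → ‖c‖ < min 1 ε →
      (∃ 𝒟 : VacuumCauchyDevelopment (AFEnd.breatheFamily B (F (EuclideanSpace.single 0 ((c 0) ^ 2))) (c 0)), 𝒟.IsMaximal) ∧ ∀ 𝒟 : VacuumCauchyDevelopment (AFEnd.breatheFamily B (F (EuclideanSpace.single 0 ((c 0) ^ 2))) (c 0)), 𝒟.IsMaximal → HasCompleteNullInfinity 𝒟.toCauchyDevelopment ∧ ∃ (O : Set 𝒟.carrier) (dd : FinalStateDecomposition 𝒟.toSpacetime O 2), (∀ i, Kerr.IsSubextremal (dd.mass i) (dd.spin i)) ∧ O = exteriorOf 𝒟.toCauchyDevelopment dd.charted ∧ RaysStayInClosure 𝒟.toCauchyDevelopment O ∧ HasExhaustiveCharts dd ∧ IsFutureOriented dd := by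
    intro c hc hcε
    have hρ0 : (EuclideanSpace.single 0 ((c 0) ^ 2) : EuclideanSpace ℝ (Fin 1)) ≠ 0 :=
      InitialDataSet.quadAxis_ne_zero hc
    have hρε : ‖(EuclideanSpace.single 0 ((c 0) ^ 2) : EuclideanSpace ℝ (Fin 1))‖ < ε :=
      (norm_quadAxis_le (hcε.le.trans (min_le_left _ _))).trans_lt (hcε.trans_le (min_le_right _ _))
    exact summit_breatheFamily B _ (c 0) (hgood _ hρ0 hρε)
  -- window control (injectivity and the everywhere form come for free)
  obtain ⟨F', hF't, hF'0, -, hF'i, hF'mem, hF'good⟩ :=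
    InitialDataSet.exists_tameCurve_of_localWindow
      (𝓓 := {D | D ∈ admissibleVacuumData X ∧ ∀ x ∉ K ∪ AFEnd.breatheCore e₁ z₀ 1, AgreeAt D d x})
      (P := fun D : InitialDataSet (𝓡 3) X ↦ (∃ 𝒟 : VacuumCauchyDevelopment D, 𝒟.IsMaximal) ∧ ∀ 𝒟 : VacuumCauchyDevelopment D, 𝒟.IsMaximal → HasCompleteNullInfinity 𝒟.toCauchyDevelopment ∧ ∃ (O : Set 𝒟.carrier) (dd : FinalStateDecomposition 𝒟.toSpacetime O 2), (∀ i, Kerr.IsSubextremal (dd.mass i) (dd.spin i)) ∧ O = exteriorOf 𝒟.toCauchyDevelopment dd.charted ∧ RaysStayInClosure 𝒟.toCauchyDevelopment O ∧ HasExhaustiveCharts dd ∧ IsFutureOriented dd) h2 h3 hε'' (fun c _ ↦ hmem c) (fun c hc hcε ↦ hsettled c hc hcε)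
  refine ⟨e₁.restrict hR₂.le, F', hF't, hF'i, hF'0.trans ((AFEnd.breatheQuad_zero B F).trans hF0),
    fun c ↦ (hF'mem c).1, ⟨K ∪ AFEnd.breatheCore e₁ z₀ 1, hK', fun c x hx ↦ (hF'mem c).2 x hx⟩, 1, one_pos,
    fun c hc _ ↦ hF'good c hc⟩

end Upgrade

/-- **Registered sub-goal `compactSettledTameAccess_of_smoothCompactExits` of the crux item
(stmt-FinalStateConjecture-18521).**  Compact settled tame access at every admissible datum from MGHD existence
(`MGHDExists`, stmt-9937), the SMOOTH COMPACT naked-data exit and the SMOOTH COMPACT censored-data exit (registered stubs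
`stub_smoothCompactNakedExit` / `stub_smoothCompactCensoredExit`: through the datum passes a smooth compactly supported
admissible deformation with settled small non-zero members) — upgraded by `exists_compactSettledAccess_of_smooth` — and, at a
settled base, the landed `stub_compactSettledBreathing` (case split on the base). [cite: Christodoulou1999, p. A24] -/
theorem compactSettledTameAccess_of_smoothCompactExits : (∀ (X : Type) [TopologicalSpace X] [ChartedSpace E3 X] [IsManifold (𝓡 3) ((⊤ : ℕ∞) : WithTop ℕ∞) X] [T2Space X] [SecondCountableTopology X] [ConnectedSpace X], ∀ D ∈ admissibleVacuumData X, (∃ 𝒟 : VacuumCauchyDevelopment D, 𝒟.IsMaximal ∧ ¬ HasCompleteNullInfinity 𝒟.toCauchyDevelopment) → ∃ F : EuclideanSpace ℝ (Fin 1) → InitialDataSet (𝓡 3) X, InitialDataSet.IsSmoothDataFamily 1 F ∧ F 0 = D ∧ (∀ c, F c ∈ admissibleVacuumData X) ∧ (∃ K : Set X, IsCompact K ∧ ∀ (c : EuclideanSpace ℝ (Fin 1)) (x : X), x ∉ K → (F c).h.inner x = D.h.inner x ∧ (F c).k x = D.k x) ∧ ∃ ε : ℝ, 0 < ε ∧ ∀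 c, c ≠ 0 → ‖c‖ < ε → ((∃ 𝒟 : VacuumCauchyDevelopment (F c), 𝒟.IsMaximal) ∧ ∀ 𝒟 : VacuumCauchyDevelopment (F c), 𝒟.IsMaximal → HasCompleteNullInfinity 𝒟.toCauchyDevelopment ∧ ∃ (O : Set 𝒟.carrier) (dd : FinalStateDecomposition 𝒟.toSpacetime O 2), (∀ i, Kerr.IsSubextremal (dd.mass i) (dd.spin i)) ∧ O = exteriorOf 𝒟.toCauchyDevelopment dd.charted ∧ RaysStayInClosure 𝒟.toCauchyDevelopment O ∧ HasExhaustiveCharts dd ∧ IsFutureOriented dd)) → (∀ (X : Type) [TopologicalSpace X] [ChartedSpace E3 X] [IsManifold (𝓡 3) ((⊤ : ℕ∞) : WithTop ℕ∞) X] [T2Space X] [SecondCountableTopology X] [ConnectedSpace X], ∀ D ∈ admissibleVacuumData X, (∃ 𝒟 : VacuumCauchyDevelopment D, 𝒟.IsMaximal) → (∀ 𝒟 : VacuumCauchyDevelopment D, 𝒟.IsMaximal → HasCompleteNullInfinity 𝒟.toCauchyDevelopment) → (∃ 𝒟 : VacuumCauchyDevelopment D, 𝒟.IsMaximal ∧ ¬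 ∃ (O : Set 𝒟.carrier) (dd : FinalStateDecomposition 𝒟.toSpacetime O 2), (∀ i, Kerr.IsSubextremal (dd.mass i) (dd.spin i)) ∧ O = exteriorOf 𝒟.toCauchyDevelopment dd.charted ∧ RaysStayInClosure 𝒟.toCauchyDevelopment O ∧ HasExhaustiveCharts dd ∧ IsFutureOriented dd) → ∃ F : EuclideanSpace ℝ (Fin 1) → InitialDataSet (𝓡 3) X, InitialDataSet.IsSmoothDataFamily 1 F ∧ F 0 = D ∧ (∀ c, F c ∈ admissibleVacuumData X) ∧ (∃ K : Set X, IsCompact K ∧ ∀ (c : EuclideanSpace ℝ (Fin 1)) (x : X), x ∉ K → (F c).h.inner x = D.h.inner x ∧ (F c).k x = D.k x) ∧ ∃ ε : ℝ, 0 < ε ∧ ∀ c, c ≠ 0 → ‖c‖ < ε → ((∃ 𝒟 : VacuumCauchyDevelopment (F c), 𝒟.IsMaximal) ∧ ∀ 𝒟 : VacuumCauchyDevelopment (F c), 𝒟.IsMaximal → HasCompleteNullInfinity 𝒟.toCauchyDevelopment ∧ ∃ (O : Set 𝒟.carrier) (dd : FinalStateDecomposition 𝒟.toSpacetime O 2),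 (∀ i, Kerr.IsSubextremal (dd.mass i) (dd.spin i)) ∧ O = exteriorOf 𝒟.toCauchyDevelopment dd.charted ∧ RaysStayInClosure 𝒟.toCauchyDevelopment O ∧ HasExhaustiveCharts dd ∧ IsFutureOriented dd)) → MGHDExists → ∀ (X : Type) [TopologicalSpace X] [ChartedSpace E3 X] [IsManifold (𝓡 3) ((⊤ : ℕ∞) : WithTop ℕ∞) X] [T2Space X] [SecondCountableTopology X] [ConnectedSpace X], ∀ d ∈ admissibleVacuumData X, ∃ (e : AFEnd X) (G : EuclideanSpace ℝ (Fin 1) → InitialDataSet (𝓡 3) X), InitialDataSet.IsTameDataFamily e 1 G ∧ InitialDataSet.IsImmersedAtZero 1 G ∧ G 0 = d ∧ (∀ c, G c ∈ admissibleVacuumData X) ∧ (∃ K : Set X, IsCompact K ∧ ∀ (c : EuclideanSpace ℝ (Fin 1)) (x : X), x ∉ K → AgreeAt (G c) d x) ∧ ∃ ε > (0 : ℝ), ∀ c, c ≠ 0 → ‖c‖ < ε → (∃ 𝒟 : VacuumCauchyDevelopment (G c), 𝒟.IsMaximal) ∧ ∀ 𝒟 : VacuumCauchyDevelopment (G c),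 𝒟.IsMaximal → HasCompleteNullInfinity 𝒟.toCauchyDevelopment ∧ ∃ (O : Set 𝒟.carrier) (dd : FinalStateDecomposition 𝒟.toSpacetime O 2), (∀ i, Kerr.IsSubextremal (dd.mass i) (dd.spin i)) ∧ O = exteriorOf 𝒟.toCauchyDevelopment dd.charted ∧ RaysStayInClosure 𝒟.toCauchyDevelopment O ∧ HasExhaustiveCharts dd ∧ IsFutureOriented dd := by
  intro hN hT hM X _ _ _ _ _ _ d hd
  have hex : ∃ 𝒟 : VacuumCauchyDevelopment d, 𝒟.IsMaximal := hM X d hd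
  by_cases hC : ∀ 𝒟 : VacuumCauchyDevelopment d, 𝒟.IsMaximal → HasCompleteNullInfinity 𝒟.toCauchyDevelopment
  · by_cases hS : ∀ 𝒟 : VacuumCauchyDevelopment d, 𝒟.IsMaximal →
        ∃ (O : Set 𝒟.carrier) (dd : FinalStateDecomposition 𝒟.toSpacetime O 2),
          (∀ i, Kerr.IsSubextremal (dd.mass i) (dd.spin i)) ∧
            O = exteriorOf 𝒟.toCauchyDevelopment dd.charted ∧
              RaysStayInClosure 𝒟.toCauchyDevelopment O ∧ HasExhaustiveCharts dd ∧ IsFutureOriented dd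
    · obtain ⟨e, G, hGt, hGi, hG0, hGadm, hGcpt, hGs⟩ :=
        stub_compactSettledBreathing X d hd ⟨hex, fun 𝒟 h𝒟 ↦ ⟨hC 𝒟 h𝒟, hS 𝒟 h𝒟⟩⟩
      exact ⟨e, G, hGt, hGi, hG0, hGadm, hGcpt, 1, one_pos, fun c _ _ ↦ hGs c⟩
    · push Not at hS
      obtain ⟨𝒟, h𝒟, hno⟩ := hS
      obtain ⟨F, hF, hF0, hFadm, ⟨K, hK, hKF⟩, ε, hε, hgood⟩ :=
        hT X d hd hex hC ⟨𝒟, h𝒟, fun ⟨O, dd, h1, h2, h3, h4, h5⟩ ↦ hno O dd h1 h2 h3 h4 h5⟩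
      exact exists_compactSettledAccess_of_smooth hd hF hF0 hFadm hK hKF hε hgood
  · push Not at hC
    obtain ⟨𝒟, h𝒟, hno⟩ := hC
    obtain ⟨F, hF, hF0, hFadm, ⟨K, hK, hKF⟩, ε, hε, hgood⟩ := hN X d hd ⟨𝒟, h𝒟, hno⟩
    exact exists_compactSettledAccess_of_smooth hd hF hF0 hFadm hK hKF hε hgood

end Summit.FinalStateConjecture.FinalStateConjecture.Theorems.ExactKerrEnds.CensorshipAlongKerrEnds

end
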